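import Summits.QuantumFields.BalabanUV.Beta.GAN24.BiStencilZeroMode
import Summits.QuantumFields.BalabanUV.Beta.GAN24.TaylorLamLeg

/-!
# `BalabanUV.Beta.GAN24.LatticeFreeze` — binder row G-an2-4 / (CONV-C), W-slot road «W3», ROW W3-F3b (T-irr) (gan24-p1-g5 `SKELETON-W3.md` v1.0.2
# §8.3∕§8.6 (F3-core-b); journal INTENT «W3-TIRR*» l.7944): THE GENERIC LATTICE TOOLKIT OF THE ONE-TAYLOR-ORDER GAIN, part 1 — leg freezing
# with a first-moment remainder and unit-gradient ⇒ Lipschitz along lattice paths (no legs, no tables — pure real analysis on `ℤ^D`;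
# part 2 = `GAN24/EnvelopeBlockSum`: the block-label wobble of (N1)-type envelopes and the one free block sum)

NOT IN PRINT; OUR PROOF ATTEMPT ([folklore] real analysis; 0 cited facts, 0 `def`, 0 `def … : Prop`, 0 wall binders).  HONEST FRAMING (cell contract,
verbatim): «discharging `BetaPertH` makes Bałaban's UV stability UNCONDITIONAL — a real constructive-QFT result; it is NOT the continuum limit and NOT the
Clay problem.»  HONEST DEPENDENCY (verbatim): «continuum YM on T⁴ ⇐ BetaPertH ∧ nine spine estimates (0/9 proved); BetaPertH ⇐ (D1) ∧ (D4) ∧ CAP+tail;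
G-an2-4 gates asym, D1 and NE2/3/4.»  Discharges NOTHING of «T2Shape» ∕ «T2SupRate» ∕ (hW₂, hW₂all); NOT «W-slot closed», NEVER «G-an2-4 closed»;
NOT `BetaPertH`, NOT continuum, NOT Clay.

## What is proved (generic dimension `D`, resp. `d+1`)
* §1 `mul_exp_neg_le` (`t·e^{−ct} ≤ (2/c)·e^{−(c/2)t}`), `l1_eq_natCast_sum_natAbs`.
* §2 **`abs_sub_le_of_unit_steps`** — UNIT GRADIENTS ⇒ LIPSCHITZ ALONG LATTICE PATHS: if `|f (p + e_i) − f p| ≤ γ·e^{κ|p − u|₁}` for all `p, i`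
  then `|f v − f u| ≤ γ·|v − u|₁·e^{κ|v − u|₁}` (induction on the `ℓ¹` distance, one coordinate step at a time, never leaving the `ℓ¹` ball).
* §3 FREEZING ONE LEG: `summable_mul_of_env`∕`abs_tsum_mul_le_of_env` (`|w| ≤ a·e^{κ|v−u|₁}·E`, `|φ| ≤ B·e^{−δ|v−u|₁}`, `κ < δ` ⇒
  `|Σ' w·φ| ≤ a·E·B·Zl(δ−κ)`) and **`abs_tsum_mul_sub_frozen_le`** (`|w v − w u| ≤ a′·|v−u|₁·e^{κ|v−u|₁}·E` ⇒
  `|Σ'_v w v·φ v − w u·Σ'_v φ v| ≤ a′·E·B·(2/(δ−κ))·Zl((δ−κ)/2)` — the FIRST-MOMENT remainder).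
Unit `b2b-balaban-gan24-formalise-leaf-12` (G-an2-4 formalisation swarm, leaf prover 12, gen 20; ROW W3-F3b holder), 2026-08-20.
-/

noncomputable section

open Finset
open scoped BigOperators
open Literature.MathematicalPhysics.QuantumFieldTheory.LatticeForm (quo)
open Literature.MathematicalPhysics.QuantumFieldTheory.Balaban1983to89
open Literature.MathematicalPhysics.QuantumFieldTheory.Balaban1983to89.Beta
open B4ContourShift (supNorm abs_le_supNorm supNorm_nonneg exists_supNorm_eq)
open B4Reflection242 (supNorm_le_of_forall supNorm_add_le)
open B12Sec2to5 (l1 l1_nonneg)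
open ExpKernelCalculus (Zl Zl_nonneg Zl_pos summable_exp_shift summable_exp_shift' tsum_exp_shift tsum_exp_shift' l1_sub_triangle l1_sub_symm)
open AffineAveraging (box toSite)
open KKTFluctuationEnergy (quo_zsmul_add_toSite)
open Summit.QuantumFields.BalabanUV.Beta.GAN24.BiStencilZeroMode (tsum_eq_sum_box_tsum)

namespace Summit.QuantumFields.BalabanUV.Beta.GAN24.LatticeFreeze

/-! ## §1 Two elementary facts -/

/-- [folklore] `t·e^{−ct} ≤ (2/c)·e^{−(c/2)·t}` for `c > 0` (from `s ≤ e^s`). -/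
theorem mul_exp_neg_le {c : ℝ} (hc : 0 < c) (t : ℝ) : t * Real.exp (-c * t) ≤ 2 / c * Real.exp (-(c / 2) * t) := by
  have h1 : c / 2 * t ≤ Real.exp (c / 2 * t) := by
    have := Real.add_one_le_exp (c / 2 * t); linarith
  have h2 : t ≤ 2 / c * Real.exp (c / 2 * t) := by
    have hc2 : 0 < c / 2 := by positivity
    calc t = (2 / c) * (c / 2 * t) := by field_simp
      _ ≤ 2 / c * Real.exp (c / 2 * t) := mul_le_mul_of_nonneg_left h1 (by positivity)
  calc t * Real.exp (-c * t) ≤ (2 / c * Real.exp (c / 2 * t)) * Real.exp (-c * t) :=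
        mul_le_mul_of_nonneg_right h2 (Real.exp_pos _).le
    _ = 2 / c * Real.exp (-(c / 2) * t) := by
        rw [mul_assoc, ← Real.exp_add]; congr 2; ring

variable {D : ℕ}

/-- [folklore] The `ℓ¹` norm as a cast natural number: `|x|₁ = ↑(Σ_i |x_i|)`. -/
theorem l1_eq_natCast_sum_natAbs (x : Fin D → ℤ) : l1 x = ((∑ i, (x i).natAbs : ℕ) : ℝ) := by
  unfold l1
  push_cast
  refine Finset.sum_congr rfl fun i _ => ?_
  rw [Nat.cast_natAbs, Int.cast_abs]

/-! ## §2 Unit gradients give a Lipschitz bound along lattice paths -/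

/-- [folklore] **UNIT GRADIENTS ⇒ LIPSCHITZ ALONG LATTICE PATHS** (with an exponentially growing allowance): if every unit step of `f` at `p` costs at
most `γ·e^{κ|p−u|₁}` then `|f v − f u| ≤ γ·|v − u|₁·e^{κ|v − u|₁}` — walk from `v` to `u` one coordinate unit at a time inside the `ℓ¹` ball of radius
`|v − u|₁` about `u`. -/
theorem abs_sub_le_of_unit_steps {f : (Fin D → ℤ) → ℝ} {u : Fin D → ℤ} {γ κ : ℝ} (hγ : 0 ≤ γ) (hκ : 0 ≤ κ)
    (h : ∀ (p : Fin D → ℤ) (i : Fin D), |f (p + Pi.single i 1) - f p| ≤ γ * Real.exp (κ * l1 (p - u))) (v : Fin D → ℤ) :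
    |f v - f u| ≤ γ * l1 (v - u) * Real.exp (κ * l1 (v - u)) := by
  -- induction on the integer ℓ¹ distance
  suffices H : ∀ (n : ℕ) (v : Fin D → ℤ), (∑ i, ((v - u) i).natAbs) = n → |f v - f u| ≤ γ * n * Real.exp (κ * n) by
    have e := l1_eq_natCast_sum_natAbs (v - u)
    have := H _ v rfl
    rw [e]; exact this
  intro n
  induction n with
  | zero =>
    intro v hv
    have hvu : v = u := by
      funext i
      have := (Finset.sum_eq_zero_iff.1 hv) i (Finset.mem_univ i)
      have : (v - u) i = 0 := Int.natAbs_eq_zero.1 this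
      simpa [sub_eq_zero] using this
    subst hvu; simp
  | succ n ih =>
    intro v hv
    -- a coordinate where `v ≠ u`
    obtain ⟨i, hi⟩ : ∃ i, ((v - u) i).natAbs ≠ 0 := by
      by_contra hcon
      push Not at hcon
      have : (∑ i, ((v - u) i).natAbs) = 0 := Finset.sum_eq_zero fun i _ => hcon i
      omega
    have hi' : (v - u) i ≠ 0 := fun h0 => hi (by rw [h0]; rfl)
    -- step one unit towards `u` in coordinate `i`
    set s : ℤ := if 0 < (v - u) i then 1 else -1 with hs
    set v' : Fin D → ℤ := v - Pi.single i s with hv'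
    have hcoord : ((v' - u) i).natAbs + 1 = ((v - u) i).natAbs := by
      have e1 : (v' - u) i = (v - u) i - s := by simp [hv', sub_right_comm]
      rw [e1, hs]
      split_ifs with hpos <;> omega
    have hother : ∀ j, j ≠ i → (v' - u) j = (v - u) j := by
      intro j hj; simp [hv', hj]
    have hsum' : (∑ j, ((v' - u) j).natAbs) = n := by
      have h1 := Finset.add_sum_erase (Finset.univ) (fun j => ((v - u) j).natAbs) (Finset.mem_univ i)
      have h2 := Finset.add_sum_erase (Finset.univ) (fun j => ((v' - u) j).natAbs) (Finset.mem_univ i)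
      have h3 : ∑ j ∈ Finset.univ.erase i, ((v' - u) j).natAbs = ∑ j ∈ Finset.univ.erase i, ((v - u) j).natAbs :=
        Finset.sum_congr rfl fun j hj => by rw [hother j (Finset.ne_of_mem_erase hj)]
      omega
    have IH := ih v' hsum'
    -- the single step from `v'` to `v`
    have hstep : |f v - f v'| ≤ γ * Real.exp (κ * (n + 1 : ℕ)) := by
      have hl1v : l1 (v - u) = ((n + 1 : ℕ) : ℝ) := by rw [l1_eq_natCast_sum_natAbs, hv]
      have hl1v' : l1 (v' - u) = (n : ℝ) := by rw [l1_eq_natCast_sum_natAbs, hsum']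
      by_cases hpos : 0 < (v - u) i
      · -- `v = v' + e_i`, base point `v'` at distance `n`
        have hs1 : s = 1 := by rw [hs, if_pos hpos]
        have ev : v = v' + Pi.single i 1 := by rw [hv', hs1]; abel
        have hb := h v' i
        rw [← ev, hl1v'] at hb
        refine hb.trans (mul_le_mul_of_nonneg_left (Real.exp_le_exp.2 ?_) hγ)
        exact mul_le_mul_of_nonneg_left (by exact_mod_cast Nat.le_succ n) hκ
      · -- `v' = v + e_i`, base point `v` at distance `n + 1`
        have hs1 : s = -1 := by rw [hs, if_neg hpos]
        have ev : v' = v + Pi.single i 1 := by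
          rw [hv', hs1, Pi.single_neg, sub_neg_eq_add]
        have hb := h v i
        rw [← ev, hl1v] at hb
        rw [abs_sub_comm]
        exact hb
    calc |f v - f u| = |(f v - f v') + (f v' - f u)| := by ring_nf
      _ ≤ |f v - f v'| + |f v' - f u| := abs_add_le _ _
      _ ≤ γ * Real.exp (κ * (n + 1 : ℕ)) + γ * n * Real.exp (κ * n) := add_le_add hstep IH
      _ ≤ γ * Real.exp (κ * (n + 1 : ℕ)) + γ * n * Real.exp (κ * (n + 1 : ℕ)) := by
          have : Real.exp (κ * n) ≤ Real.exp (κ * (n + 1 : ℕ)) :=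
            Real.exp_le_exp.2 (mul_le_mul_of_nonneg_left (by exact_mod_cast Nat.le_succ n) hκ)
          have hn : (0 : ℝ) ≤ γ * n := by positivity
          nlinarith
      _ = γ * ((n + 1 : ℕ) : ℝ) * Real.exp (κ * (n + 1 : ℕ)) := by push_cast; ring

/-! ## §3 Freezing one leg: size and first-moment remainder -/

section Freeze

variable {w φ : (Fin D → ℤ) → ℝ} {u : Fin D → ℤ} {a a' E B δ κ : ℝ}

/-- [folklore] A leg with an exponentially growing allowance against an exponentially decaying weight is absolutely summable, `κ < δ`. -/
theorem summable_mul_of_env (hκδ : κ < δ) (ha : 0 ≤ a) (hE : 0 ≤ E)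
    (hw : ∀ v, |w v| ≤ a * Real.exp (κ * l1 (v - u)) * E) (hφ : ∀ v, |φ v| ≤ B * Real.exp (-δ * l1 (v - u))) :
    Summable fun v => w v * φ v := by
  have hB : 0 ≤ B := by
    have h0 := hφ u
    rw [sub_self, show l1 (0 : Fin D → ℤ) = 0 by simp [l1], mul_zero, Real.exp_zero, mul_one] at h0
    exact (abs_nonneg _).trans h0
  refine Summable.of_norm_bounded ((summable_exp_shift' (sub_pos.2 hκδ) u).mul_left (a * E * B)) (fun v => ?_)
  rw [Real.norm_eq_abs, abs_mul]
  calc |w v| * |φ v| ≤ (a * Real.exp (κ * l1 (v - u)) * E) * (B * Real.exp (-δ * l1 (v - u))) :=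
        mul_le_mul (hw v) (hφ v) (abs_nonneg _) (by positivity)
    _ = a * E * B * Real.exp (-(δ - κ) * l1 (v - u)) := by
        have : Real.exp (κ * l1 (v - u)) * Real.exp (-δ * l1 (v - u)) = Real.exp (-(δ - κ) * l1 (v - u)) := by
          rw [← Real.exp_add]; congr 1; ring
        calc (a * Real.exp (κ * l1 (v - u)) * E) * (B * Real.exp (-δ * l1 (v - u)))
            = a * E * B * (Real.exp (κ * l1 (v - u)) * Real.exp (-δ * l1 (v - u))) := by ring
          _ = _ := by rw [this]

/-- [folklore] **SIZE OF ONE FROZEN-OR-NOT LEG SUM**: `|Σ'_v w v·φ v| ≤ a·E·B·Zl(δ−κ)`. -/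
theorem abs_tsum_mul_le_of_env (hκδ : κ < δ) (ha : 0 ≤ a) (hE : 0 ≤ E)
    (hw : ∀ v, |w v| ≤ a * Real.exp (κ * l1 (v - u)) * E) (hφ : ∀ v, |φ v| ≤ B * Real.exp (-δ * l1 (v - u))) :
    |∑' v, w v * φ v| ≤ a * E * B * Zl D (δ - κ) := by
  have hB : 0 ≤ B := by
    have h0 := hφ u
    rw [sub_self, show l1 (0 : Fin D → ℤ) = 0 by simp [l1], mul_zero, Real.exp_zero, mul_one] at h0
    exact (abs_nonneg _).trans h0
  have hs := (summable_exp_shift' (sub_pos.2 hκδ) u).mul_left (a * E * B)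
  have hb := tsum_of_norm_bounded hs.hasSum (f := fun v => w v * φ v) (fun v => by
    rw [Real.norm_eq_abs, abs_mul]
    calc |w v| * |φ v| ≤ (a * Real.exp (κ * l1 (v - u)) * E) * (B * Real.exp (-δ * l1 (v - u))) :=
          mul_le_mul (hw v) (hφ v) (abs_nonneg _) (by positivity)
      _ = a * E * B * Real.exp (-(δ - κ) * l1 (v - u)) := by
          have : Real.exp (κ * l1 (v - u)) * Real.exp (-δ * l1 (v - u)) = Real.exp (-(δ - κ) * l1 (v - u)) := by
            rw [← Real.exp_add]; congr 1; ring
          calc (a * Real.exp (κ * l1 (v - u)) * E) * (B * Real.exp (-δ * l1 (v - u)))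
              = a * E * B * (Real.exp (κ * l1 (v - u)) * Real.exp (-δ * l1 (v - u))) := by ring
            _ = _ := by rw [this])
  rw [Real.norm_eq_abs] at hb
  refine hb.trans (le_of_eq ?_)
  rw [tsum_mul_left, tsum_exp_shift']

/-- [folklore] **THE FIRST-MOMENT REMAINDER OF FREEZING ONE LEG AT THE BASE POINT**: if `|w v − w u| ≤ a′·|v−u|₁·e^{κ|v−u|₁}·E` and
`|φ v| ≤ B·e^{−δ|v−u|₁}` with `κ < δ`, then `|Σ'_v w v·φ v − w u·Σ'_v φ v| ≤ a′·E·B·(2/(δ−κ))·Zl((δ−κ)/2)`. -/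
theorem abs_tsum_mul_sub_frozen_le (hκδ : κ < δ) (hκ : 0 ≤ κ) (ha' : 0 ≤ a') (hE : 0 ≤ E)
    (hw' : ∀ v, |w v - w u| ≤ a' * l1 (v - u) * Real.exp (κ * l1 (v - u)) * E)
    (hφ : ∀ v, |φ v| ≤ B * Real.exp (-δ * l1 (v - u))) (hwφ : Summable fun v => w v * φ v) :
    |∑' v, w v * φ v - w u * ∑' v, φ v| ≤ a' * E * B * (2 / (δ - κ) * Zl D ((δ - κ) / 2)) := by
  have hB : 0 ≤ B := by
    have h0 := hφ u
    rw [sub_self, show l1 (0 : Fin D → ℤ) = 0 by simp [l1], mul_zero, Real.exp_zero, mul_one] at h0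
    exact (abs_nonneg _).trans h0
  have hδκ : 0 < δ - κ := sub_pos.2 hκδ
  have hφs : Summable φ := by
    refine Summable.of_norm_bounded ((summable_exp_shift' (hκ.trans_lt hκδ) u).mul_left B) (fun v => ?_)
    rw [Real.norm_eq_abs]; exact hφ v
  have hdiff : (∑' v, w v * φ v) - w u * ∑' v, φ v = ∑' v, (w v - w u) * φ v := by
    rw [← tsum_mul_left, ← hwφ.tsum_sub (hφs.mul_left (w u))]
    exact tsum_congr fun v => by ring
  rw [hdiff]
  have hs := (summable_exp_shift' (half_pos hδκ) u).mul_left (a' * E * B * (2 / (δ - κ)))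
  have hb := tsum_of_norm_bounded hs.hasSum (f := fun v => (w v - w u) * φ v) (fun v => by
    rw [Real.norm_eq_abs, abs_mul]
    have hm := mul_exp_neg_le hδκ (l1 (v - u))
    calc |w v - w u| * |φ v| ≤ (a' * l1 (v - u) * Real.exp (κ * l1 (v - u)) * E) * (B * Real.exp (-δ * l1 (v - u))) :=
          mul_le_mul (hw' v) (hφ v) (abs_nonneg _) (by have := l1_nonneg (v - u); positivity)
      _ = a' * E * B * (l1 (v - u) * Real.exp (-(δ - κ) * l1 (v - u))) := by
          have : Real.exp (κ * l1 (v - u)) * Real.exp (-δ * l1 (v - u)) = Real.exp (-(δ - κ) * l1 (v - u)) := by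
            rw [← Real.exp_add]; congr 1; ring
          calc (a' * l1 (v - u) * Real.exp (κ * l1 (v - u)) * E) * (B * Real.exp (-δ * l1 (v - u)))
              = a' * E * B * (l1 (v - u) * (Real.exp (κ * l1 (v - u)) * Real.exp (-δ * l1 (v - u)))) := by ring
            _ = _ := by rw [this]
      _ ≤ a' * E * B * (2 / (δ - κ) * Real.exp (-((δ - κ) / 2) * l1 (v - u))) :=
          mul_le_mul_of_nonneg_left hm (by positivity)
      _ = a' * E * B * (2 / (δ - κ)) * Real.exp (-((δ - κ) / 2) * l1 (v - u)) := by ring)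
  rw [Real.norm_eq_abs] at hb
  refine hb.trans (le_of_eq ?_)
  rw [tsum_mul_left, tsum_exp_shift']
  ring

end Freeze

end Summit.QuantumFields.BalabanUV.Beta.GAN24.LatticeFreeze

end
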